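import Mathlib
import Summits.MatrixMultiplication.MatrixMultiplication.Theses.CatalyticDegeneration
import Literature.Computability.AlgebraicComplexity.AsymptoticRankMultiplesMatMul
import Literature.Computability.AlgebraicComplexity.TensorSemiringSpectrum
import Literature.Computability.AlgebraicComplexity.QuantumFunctionalsDirectSumMarginals

/-!
# `CatalyticDegeneration.CatalyticTransfer` (stmt-MatrixMultiplication-3639) — proved

Route `MatrixMultiplication/CatalyticDegeneration`, support item `CatalyticTransfer` (soundness of
the catalytic mechanism): for `n ≥ 2`, `r ≥ 1` and any bystander `C`, a catalytic identity
`⟨r⟩ ⊕ C ⊵ ⟨n,n,n⟩ ⊕ C` (Alman's algebraic `K[λ]`-degeneration `PolyDegeneratesTo`) implies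
`ω(ℂ) ≤ log_n r`.

Proof ("from the cone", as sketched in the route file; everything below is proved, no named facts).
* `polyDegeneratesTo_directSum` — **degeneration is compatible with direct sums** (the lemma
  `PolyDegeneratesTo.directSum` the route file asks for): equalise the orders of the two
  degenerations by multiplying the third family of maps by a power of `λ` (`isPolyDegen_shift`),
  then substitute block-diagonally (`polySubst_directSum_blockDiag`, `isPolyDegen_directSum`).
* `polyDegeneratesTo_of_mk_le` — a degeneration may be pre- or post-composed with restrictions, so it
  only depends on the classes in the commutative semiring `T(K) = TensorClass K` of tensors modulo
  restriction-equivalence (`TensorSemiring.lean`); every re-bracketing of direct sums below is an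
  identity in that semiring (`ring`).
* `catalyst_iterate` — iterating with the catalyst returned:
  `⟨N r⟩ ⊕ C ⊵ (⟨N⟩ ⊗ ⟨n,n,n⟩) ⊕ C` for every `N`.
* `unitTensor_polyDegeneratesTo_multiple_of_catalytic` — drop `C` on the right (`x ≤ x + [C]`)
  and replace it by `⟨R(C)⟩` on the left (`[C] ≤ R(C)`): `⟨N r + R(C)⟩ ⊵ ⟨N⟩ ⊗ ⟨n,n,n⟩`.
* `rpow_omega_le_of_catalytic` — `R̃` is degeneration-monotone
  (`asymptoticRank_le_of_polyDegeneratesTo`), `R̃(⟨N⟩ ⊗ ⟨n,n,n⟩) = N · n^ω`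
  (`asymptoticRank_multiple_matMulTensor_cube`) and `R̃(⟨m⟩) ≤ m`, so `N n^ω ≤ N r + R(C)` for
  all `N ≥ 1`, whence `n^ω ≤ r`; finally `ω = log_n n^ω ≤ log_n r` (`catalyticTransfer_proof`).
-/

noncomputable section

open scoped BigOperators Polynomial

-- the tree's namespace `Summit.MatrixMultiplication.MatrixMultiplication.…` repeats a component by design (D-0017)
set_option linter.dupNamespace false

namespace Summit.MatrixMultiplication.MatrixMultiplication.Theorems

open Literature.Computability.AlgebraicComplexity
open Literature.Barriers.MatrixMultiplication

universe u

/-! ## Degeneration is compatible with direct sums -/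

section DirectSum

variable {K : Type u} [CommSemiring K]
variable {ι κ μ ι' κ' μ' ι₁ κ₁ μ₁ ι₁' κ₁' μ₁' : Type*}

/-- **Shifting the order of a degeneration**: if `(A, B, C)` degenerates `t` to `s` with order `h`,
then `(A, B, λ^k C)` degenerates `t` to `s` with order `h + k`. [folklore] -/
theorem isPolyDegen_shift [Fintype ι] [Fintype κ] [Fintype μ] {h : ℕ} {t : ι → κ → μ → K}
    {s : ι' → κ' → μ' → K} {A : ι → ι' → K[X]} {B : κ → κ' → K[X]} {C : μ → μ' → K[X]}
    (hd : IsPolyDegen h t s A B C) (k : ℕ) :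
    IsPolyDegen (h + k) t s A B (fun c c' => Polynomial.X ^ k * C c c') := by
  intro a' b' c' j hj
  have key : polySubst t A B (fun c c' => Polynomial.X ^ k * C c c') a' b' c' =
      Polynomial.X ^ k * polySubst t A B C a' b' c' := by
    simp only [polySubst, Finset.mul_sum]
    refine Finset.sum_congr rfl fun a _ => Finset.sum_congr rfl fun b _ =>
      Finset.sum_congr rfl fun c _ => ?_
    ring
  rw [key, Polynomial.coeff_X_pow_mul']
  by_cases hkj : k ≤ j
  · rw [if_pos hkj, hd a' b' c' (j - k) (by omega)]
    by_cases hjh : j - k = h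
    · rw [if_pos hjh, if_pos (by omega)]
    · rw [if_neg hjh, if_neg (by omega)]
  · rw [if_neg hkj, if_neg (by omega)]

/-- **Block-diagonal substitution in a direct sum** is the direct sum (over `K[λ]`) of the two
substituted tensors. [folklore] -/
theorem polySubst_directSum_blockDiag [Fintype ι] [Fintype κ] [Fintype μ] [Fintype ι₁]
    [Fintype κ₁] [Fintype μ₁] (t : ι → κ → μ → K) (t₁ : ι₁ → κ₁ → μ₁ → K)
    (A : ι → ι' → K[X]) (B : κ → κ' → K[X]) (C : μ → μ' → K[X]) (A₁ : ι₁ → ι₁' → K[X])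
    (B₁ : κ₁ → κ₁' → K[X]) (C₁ : μ₁ → μ₁' → K[X]) :
    polySubst (directSumTensor t t₁) (blockDiag A A₁) (blockDiag B B₁) (blockDiag C C₁) =
      directSumTensor (polySubst t A B C) (polySubst t₁ A₁ B₁ C₁) := by
  funext x y z
  rcases x with x | x <;> rcases y with y | y <;> rcases z with z | z <;>
    simp [polySubst, Fintype.sum_sum_type]

/-- **Direct sum of two degenerations of the same order** (block-diagonal maps). [folklore] -/
theorem isPolyDegen_directSum [Fintype ι] [Fintype κ] [Fintype μ] [Fintype ι₁] [Fintype κ₁]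
    [Fintype μ₁] {h : ℕ} {t : ι → κ → μ → K} {s : ι' → κ' → μ' → K} {A : ι → ι' → K[X]}
    {B : κ → κ' → K[X]} {C : μ → μ' → K[X]} (hd : IsPolyDegen h t s A B C)
    {t₁ : ι₁ → κ₁ → μ₁ → K} {s₁ : ι₁' → κ₁' → μ₁' → K} {A₁ : ι₁ → ι₁' → K[X]}
    {B₁ : κ₁ → κ₁' → K[X]} {C₁ : μ₁ → μ₁' → K[X]} (hd₁ : IsPolyDegen h t₁ s₁ A₁ B₁ C₁) :
    IsPolyDegen h (directSumTensor t t₁) (directSumTensor s s₁) (blockDiag A A₁) (blockDiag B B₁)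
      (blockDiag C C₁) := by
  intro x y z j hj
  rw [polySubst_directSum_blockDiag]
  rcases x with x | x <;> rcases y with y | y <;> rcases z with z | z
  · rw [directSumTensor_inl, directSumTensor_inl]
    exact hd x y z j hj
  · rw [directSumTensor_inl_inl_inr, directSumTensor_inl_inl_inr, Polynomial.coeff_zero,
      ite_self]
  · rw [directSumTensor_inl_inr, directSumTensor_inl_inr, Polynomial.coeff_zero, ite_self]
  · rw [directSumTensor_inl_inr, directSumTensor_inl_inr, Polynomial.coeff_zero, ite_self]
  · rw [directSumTensor_inr_inl, directSumTensor_inr_inl, Polynomial.coeff_zero, ite_self]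
  · rw [directSumTensor_inr_inl, directSumTensor_inr_inl, Polynomial.coeff_zero, ite_self]
  · rw [directSumTensor_inr_inr_inl, directSumTensor_inr_inr_inl, Polynomial.coeff_zero,
      ite_self]
  · rw [directSumTensor_inr, directSumTensor_inr]
    exact hd₁ x y z j hj

/-- **Degeneration is compatible with direct sums**: `t ⊵ s` and `t₁ ⊵ s₁` imply
`t ⊕ t₁ ⊵ s ⊕ s₁` (equalise the orders by `isPolyDegen_shift`, then block-diagonal maps). This is
the lemma `PolyDegeneratesTo.directSum` requested by the route file (Alman 2021 §2.4 uses it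
tacitly; Strassen 1987). [folklore] -/
theorem polyDegeneratesTo_directSum [Fintype ι] [Fintype κ] [Fintype μ] [Fintype ι₁]
    [Fintype κ₁] [Fintype μ₁] {t : ι → κ → μ → K} {s : ι' → κ' → μ' → K}
    {t₁ : ι₁ → κ₁ → μ₁ → K} {s₁ : ι₁' → κ₁' → μ₁' → K} (hts : PolyDegeneratesTo t s)
    (hts₁ : PolyDegeneratesTo t₁ s₁) :
    PolyDegeneratesTo (directSumTensor t t₁) (directSumTensor s s₁) := by
  obtain ⟨h, A, B, C, hd⟩ := hts
  obtain ⟨h₁, A₁, B₁, C₁, hd₁⟩ := hts₁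
  have hd' := isPolyDegen_shift hd h₁
  have hd₁' := isPolyDegen_shift hd₁ h
  rw [add_comm] at hd₁'
  exact (isPolyDegen_directSum hd' hd₁').polyDegeneratesTo

/-- Degeneration is reflexive (the identity restriction). [folklore] -/
theorem polyDegeneratesTo_refl [Fintype ι] [Fintype κ] [Fintype μ] [DecidableEq ι]
    [DecidableEq κ] [DecidableEq μ] (t : ι → κ → μ → K) : PolyDegeneratesTo t t :=
  (TensorRestrictsTo.refl t).polyDegeneratesTo

end DirectSum

/-! ## Degeneration descends to the semiring `T(K)` of restriction classes -/

section Transfer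

variable {K : Type u} [CommSemiring K]
variable {ι κ μ ι' κ' μ' ι₁ κ₁ μ₁ ι₁' κ₁' μ₁' : Type*}
  [Fintype ι] [Fintype κ] [Fintype μ] [Fintype ι'] [Fintype κ'] [Fintype μ']
  [Fintype ι₁] [Fintype κ₁] [Fintype μ₁] [Fintype ι₁'] [Fintype κ₁'] [Fintype μ₁']

/-- **Degeneration only depends on restriction classes**: if `t ⊵ s`, `[t] ≤ [t']` (i.e. `t' ≥ t`)
and `[s'] ≤ [s]` (i.e. `s ≥ s'`) in `T(K)`, then `t' ⊵ s'`. [folklore] -/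
theorem polyDegeneratesTo_of_mk_le {t : ι → κ → μ → K} {s : ι' → κ' → μ' → K}
    {t' : ι₁ → κ₁ → μ₁ → K} {s' : ι₁' → κ₁' → μ₁' → K} (h : PolyDegeneratesTo t s)
    (ht : TensorClass.mk t ≤ TensorClass.mk t') (hs : TensorClass.mk s' ≤ TensorClass.mk s) :
    PolyDegeneratesTo t' s' :=
  ((TensorClass.mk_le_mk_iff.1 ht).trans_polyDegeneratesTo h).trans_restrictsTo
    (TensorClass.mk_le_mk_iff.1 hs)

/-- Transport of a degeneration along equalities of restriction classes. [folklore] -/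
theorem polyDegeneratesTo_of_mk_eq {t : ι → κ → μ → K} {s : ι' → κ' → μ' → K}
    {t' : ι₁ → κ₁ → μ₁ → K} {s' : ι₁' → κ₁' → μ₁' → K} (h : PolyDegeneratesTo t s)
    (ht : TensorClass.mk t' = TensorClass.mk t) (hs : TensorClass.mk s' = TensorClass.mk s) :
    PolyDegeneratesTo t' s' :=
  polyDegeneratesTo_of_mk_le h ht.ge hs.le

end Transfer

/-! ## Iterating a catalytic identity -/

section Iterate

variable {K : Type u} [CommSemiring K]
variable {ι κ μ ι' κ' μ' : Type*} [Fintype ι] [Fintype κ] [Fintype μ] [Fintype ι'] [Fintype κ']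
  [Fintype μ'] [DecidableEq ι] [DecidableEq κ] [DecidableEq μ] [DecidableEq ι'] [DecidableEq κ']
  [DecidableEq μ']

/-- **Iterating with the catalyst returned.** If `⟨r⟩ ⊕ C ⊵ M ⊕ C` then
`⟨N r⟩ ⊕ C ⊵ (⟨N⟩ ⊗ M) ⊕ C` for every `N`: by induction,
`⟨(N+1) r⟩ ⊕ C ≅ ⟨r⟩ ⊕ (⟨N r⟩ ⊕ C) ⊵ ⟨r⟩ ⊕ ((⟨N⟩ ⊗ M) ⊕ C) ≅ (⟨r⟩ ⊕ C) ⊕ (⟨N⟩ ⊗ M)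
⊵ (M ⊕ C) ⊕ (⟨N⟩ ⊗ M) ≅ (⟨N+1⟩ ⊗ M) ⊕ C`, the `≅` being identities in `T(K)`. [folklore] -/
theorem catalyst_iterate {r : ℕ} {M : ι → κ → μ → K} {C : ι' → κ' → μ' → K}
    (h : PolyDegeneratesTo (directSumTensor (unitTensor K r) C) (directSumTensor M C)) (N : ℕ) :
    PolyDegeneratesTo (directSumTensor (unitTensor K (N * r)) C)
      (directSumTensor (kroneckerTensor (unitTensor K N) M) C) := by
  induction N with
  | zero =>
    refine polyDegeneratesTo_of_mk_eq (polyDegeneratesTo_refl C) ?_ ?_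
    · simp only [← TensorClass.mk_add_mk, ← TensorClass.natCast_eq_mk]
      push_cast
      ring
    · simp only [← TensorClass.mk_add_mk, ← TensorClass.mk_mul_mk, ← TensorClass.natCast_eq_mk]
      push_cast
      ring
  | succ N ih =>
    have h1 : PolyDegeneratesTo (directSumTensor (unitTensor K ((N + 1) * r)) C)
        (directSumTensor (unitTensor K r)
          (directSumTensor (kroneckerTensor (unitTensor K N) M) C)) := by
      refine polyDegeneratesTo_of_mk_eq
        (polyDegeneratesTo_directSum (polyDegeneratesTo_refl (unitTensor K r)) ih) ?_ rfl
      simp only [← TensorClass.mk_add_mk, ← TensorClass.natCast_eq_mk]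
      push_cast
      ring
    have h2 : PolyDegeneratesTo
        (directSumTensor (unitTensor K r) (directSumTensor (kroneckerTensor (unitTensor K N) M) C))
        (directSumTensor (kroneckerTensor (unitTensor K (N + 1)) M) C) := by
      refine polyDegeneratesTo_of_mk_eq
        (polyDegeneratesTo_directSum h (polyDegeneratesTo_refl (kroneckerTensor (unitTensor K N) M)))
        ?_ ?_
      · simp only [← TensorClass.mk_add_mk, ← TensorClass.mk_mul_mk, ← TensorClass.natCast_eq_mk]
        ring
      · simp only [← TensorClass.mk_add_mk, ← TensorClass.mk_mul_mk, ← TensorClass.natCast_eq_mk]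
        push_cast
        ring
    exact h1.trans h2

/-- **Dropping the catalyst.** If `⟨r⟩ ⊕ C ⊵ M ⊕ C` then `⟨N r + R(C)⟩ ⊵ ⟨N⟩ ⊗ M` for every
`N` (`(⟨N⟩ ⊗ M) ⊕ C ≥ ⟨N⟩ ⊗ M` by projection and `⟨N r⟩ ⊕ C ≤ ⟨N r⟩ ⊕ ⟨R(C)⟩ ≅ ⟨N r + R(C)⟩`).
[folklore] -/
theorem unitTensor_polyDegeneratesTo_multiple_of_catalytic {r : ℕ} {M : ι → κ → μ → K}
    {C : ι' → κ' → μ' → K}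
    (h : PolyDegeneratesTo (directSumTensor (unitTensor K r) C) (directSumTensor M C)) (N : ℕ) :
    PolyDegeneratesTo (unitTensor K (N * r + tensorRank C)) (kroneckerTensor (unitTensor K N) M) := by
  refine polyDegeneratesTo_of_mk_le (catalyst_iterate h N) ?_ ?_
  · rw [← TensorClass.mk_add_mk, ← TensorClass.natCast_eq_mk, ← TensorClass.natCast_eq_mk,
      Nat.cast_add]
    exact TensorClass.add_le_add le_rfl (TensorClass.mk_le_natCast_tensorRank C)
  · rw [← TensorClass.mk_add_mk]
    calc TensorClass.mk (kroneckerTensor (unitTensor K N) M)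
        = TensorClass.mk (kroneckerTensor (unitTensor K N) M) + 0 := (add_zero _).symm
      _ ≤ TensorClass.mk (kroneckerTensor (unitTensor K N) M) + TensorClass.mk C :=
        TensorClass.add_le_add le_rfl (TensorClass.zero_le _)

end Iterate

/-! ## The catalytic transfer -/

section Omega

variable (K : Type) [Field K]

/-- **`n^ω ≤ r` from a catalytic identity `⟨r⟩ ⊕ C ⊵ ⟨n,n,n⟩ ⊕ C`** (`n ≥ 1`): for every
`N ≥ 1`, `N · n^ω = R̃(⟨N⟩ ⊗ ⟨n,n,n⟩) ≤ R̃(⟨N r + R(C)⟩) ≤ N r + R(C)`, and `N → ∞`. [folklore] -/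
theorem rpow_omega_le_of_catalytic {n r : ℕ} {ι' κ' μ' : Type} [Fintype ι'] [Fintype κ']
    [Fintype μ'] [DecidableEq ι'] [DecidableEq κ'] [DecidableEq μ'] {C : ι' → κ' → μ' → K}
    (hn : 1 ≤ n)
    (h : PolyDegeneratesTo (directSumTensor (unitTensor K r) C)
      (directSumTensor (matMulTensor K n n n) C)) :
    (n : ℝ) ^ omega K ≤ r := by
  -- for all `N ≥ 1`: `N n^ω ≤ N r + R(C)`
  have key : ∀ N : ℕ, 1 ≤ N →
      (N : ℝ) * (n : ℝ) ^ omega K ≤ (N : ℝ) * r + (tensorRank C : ℝ) := by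
    intro N hN
    have h1 := asymptoticRank_le_of_polyDegeneratesTo
      (unitTensor_polyDegeneratesTo_multiple_of_catalytic h N)
    rw [asymptoticRank_multiple_matMulTensor_cube K hn hN] at h1
    refine h1.trans ?_
    exact_mod_cast asymptoticRank_unitTensor_le K (N * r + tensorRank C)
  refine le_of_forall_pos_le_add fun ε hε => ?_
  obtain ⟨N, hN⟩ := exists_nat_gt ((tensorRank C : ℝ) / ε)
  have hNpos : (0 : ℝ) < N := lt_of_le_of_lt (by positivity) hN
  have hN1 : 1 ≤ N := Nat.one_le_iff_ne_zero.2 (by rintro rfl; simp at hNpos)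
  have hk := key N hN1
  have hRC : (tensorRank C : ℝ) < N * ε := by rwa [div_lt_iff₀ hε] at hN
  have hle : (N : ℝ) * (n : ℝ) ^ omega K ≤ N * (r + ε) := by nlinarith
  exact le_of_mul_le_mul_left hle hNpos

/-- **Catalytic Bini–Schönhage transfer** (route `CatalyticDegeneration`, support item
`CatalyticTransfer`, stmt-MatrixMultiplication-3639): for `n ≥ 2`, `r ≥ 1` and any bystander `C`,
`⟨r⟩ ⊕ C ⊵ ⟨n,n,n⟩ ⊕ C` implies `ω(ℂ) ≤ log_n r` (`n^ω ≤ r` by `rpow_omega_le_of_catalytic`, and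
`ω = log_n n^ω`). [folklore] -/
theorem catalyticTransfer_proof :
    Summit.MatrixMultiplication.MatrixMultiplication.Theses.CatalyticDegeneration.CatalyticTransfer := by
  intro n r a b c C hn hr hdeg
  have hpow := rpow_omega_le_of_catalytic ℂ (by omega) hdeg
  have hn1 : (1 : ℝ) < n := by exact_mod_cast hn
  have hn0 : (0 : ℝ) < n := by positivity
  calc omega ℂ = Real.logb n ((n : ℝ) ^ omega ℂ) := (Real.logb_rpow hn0 hn1.ne').symm
    _ ≤ Real.logb n r := Real.logb_le_logb_of_le hn1 (Real.rpow_pos_of_pos hn0 _) hpow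

end Omega

end Summit.MatrixMultiplication.MatrixMultiplication.Theorems

end
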